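import Summits.QuantumFields.YangMills.Theorems.BalabanUVNodesN19FejerSteklovSmoothing
import Mathlib.Analysis.Normed.Group.AddCircle

/-!
# YM-DAG node N19 (= NE7 proper) — TRIGONOMETRIC SMOOTHING OF A LIPSCHITZ LINK ON `[0, d]`
# (the `2d`-periodic even extension through `‖·‖_{ℝ∕2πℤ}`, Fejér–Steklov smoothing, rescaling `θ = πs∕d`: module 151's input, priced by `Lip h`)

Cell `pub-ymgap`, HUMAN RULING D-0062 (Track A) ∕ D-0149 (work-bound push), R141 (C) wider-strategy seat `pub-ymgap-dag-n19-e` (strategy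
s3 = ALTERNATIVE CURRENCY), generation g33, module 4 (lineage module 152a).  Route `Summits/QuantumFields/YangMills/Theses/BalabanUVNodes.lean`,
cluster item K3⁸ «SpineGivenEndpointR13SepCoPHV» (stmt-QuantumFields-27366); filed `--supports` that item `--as helper` (it proves no registered
stub).  COUNT-NEUTRAL: [folklore]∕[bookkeeping] over Mathlib (`AddCircle`: `AddCircle.norm_coe_eq_abs_iff`, `AddCircle.norm_le_half_period`,
`QuotientAddGroup.norm_mk_le_norm`; `LipschitzOnWith.continuousOn`) and, BY NAME, module 150b `…N19FejerSteklovSmoothing`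
(`exists_trigLink_near_periodicLipschitz`); no laws, no scheme object, no Theses import; NOT a discharge claim.

ROLE IN THE LINEAGE.  The smoothing step of the SMOOTHED-LINK FIRST-ORDER LAW in the units of the cube: a `K`-Lipschitz link `h` on `[0, d]`
(`d = |ι|`, the range of `S_d = Σ_i|x_i|`) is transported to the circle by `f(θ) = h((d∕π)‖θ‖) − h(0)` (`‖θ‖` the distance to `2πℤ`: `1`-Lipschitz,
`2π`-periodic, `= θ` on `[0, π]`; so `f` is continuous, `2π`-periodic, `(Kd∕π)`-Lipschitz, `|f| ≤ Kd`, `f(πs∕d) = h(s) − h(0)` on `[0, d]`), smoothed by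
module 150b (Fejér order `L`, Steklov width `δ = 1∕L`), and rescaled back (`θ = πs∕d`; frequencies `ω_p·π∕d ≤ Lπ∕d`).
§1 the distance to `2πℤ` (`circleNorm` facts: nonneg, `≤ π`, `1`-Lipschitz, periodic, `= θ` on `[0, π]`); §2 ★★ `exists_trigLink_near_lipschitzLink`:
for `d > 0`, `K ≥ 0`, `h` `K`-Lipschitz on `[0, d]`, `L ≥ 1`: a trigonometric link `g(s) = h(0) + Σ_p(α_p cos(ω_ps) + β_p sin(ω_ps))`
(`p ∈ range L × range L`, `0 ≤ ω_p ≤ Lπ∕d`, `Σ_p(|α_p| + |β_p|) ≤ 2LKd`) with derivative `g₁ = Σ_p ω_p(β_p cos − α_p sin)`,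
`|g(u) − g(a) − g₁(a)(u − a)| ≤ (KπL∕d)(u − a)²`, `|g₁| ≤ K` on `ℝ`, and `|h(s) − g(s)| ≤ Kd(1∕π + 1 + log L)∕L` on `[0, d]` — module 151's input with
`B₂ = KπL∕d`, `B₁ = K`, `W = 2LKd`, `Ω = Lπ∕d` (so `Ωd = Lπ`), all priced by `K`.  PART 3 (`…N19LipschitzLinksDegreeBudget`) chooses `L ≍ t∕log₂²t`.

HONEST FRAMING (binding).  Elementary and [folklore]; NO consumer in the DAG today (a step of an optimality map of the seat's own currency, degree
model); nothing of Bałaban's instantiated; NE7 NOT PRINTED, NOT proved; N19 NOT discharged; count-neutral.  One finite `T⁴` programme at fixed `ε`;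
nothing continuum ∕ `ℝ⁴` ∕ OS ∕ mass-gap ∕ Clay.  0 `def` ∕ 0 `sorry`.
-/

noncomputable section

open Finset
open scoped Real

namespace Summit.QuantumFields.YangMills.Theorems.BalabanUVNodesN19LipschitzLinkTrigSmoothing

open Summit.QuantumFields.YangMills.Theorems.BalabanUVNodesN19FejerSteklovSmoothing (exists_trigLink_near_periodicLipschitz)

/-! ## §1 The distance to `2πℤ` [bookkeeping] -/

/-- `0 ≤ ‖θ‖_{ℝ∕2πℤ} ≤ π`. [bookkeeping] -/
theorem circleNorm_mem_Icc (θ : ℝ) : 0 ≤ ‖((θ : ℝ) : AddCircle (2 * π))‖ ∧ ‖((θ : ℝ) : AddCircle (2 * π))‖ ≤ π := by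
  refine ⟨norm_nonneg _, ?_⟩
  have h := AddCircle.norm_le_half_period (2 * π) (x := ((θ : ℝ) : AddCircle (2 * π))) (by positivity)
  rw [abs_of_pos (by positivity : (0 : ℝ) < 2 * π)] at h
  linarith

/-- The distance to `2πℤ` is `1`-Lipschitz: `|‖a‖ − ‖b‖| ≤ |a − b|`. [bookkeeping] -/
theorem abs_circleNorm_sub_le (a b : ℝ) :
    |‖((a : ℝ) : AddCircle (2 * π))‖ - ‖((b : ℝ) : AddCircle (2 * π))‖| ≤ |a - b| := by
  refine (abs_norm_sub_norm_le _ _).trans ?_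
  rw [← AddCircle.coe_sub]
  have h := QuotientAddGroup.norm_mk_le_norm (S := AddSubgroup.zmultiples (2 * π)) (m := a - b)
  simpa using h

/-- The distance to `2πℤ` is `2π`-periodic. [bookkeeping] -/
theorem circleNorm_add_two_pi (θ : ℝ) : ‖((θ + 2 * π : ℝ) : AddCircle (2 * π))‖ = ‖((θ : ℝ) : AddCircle (2 * π))‖ := by
  rw [AddCircle.coe_add_period]

/-- On `[0, π]` the distance to `2πℤ` is the identity. [bookkeeping] -/
theorem circleNorm_of_mem_Icc {θ : ℝ} (h0 : 0 ≤ θ) (hπ : θ ≤ π) : ‖((θ : ℝ) : AddCircle (2 * π))‖ = θ := by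
  rw [(AddCircle.norm_coe_eq_abs_iff (2 * π) (by positivity)).2, abs_of_nonneg h0]
  rw [abs_of_pos (by positivity : (0 : ℝ) < 2 * π), abs_of_nonneg h0]
  linarith

/-- The distance to `2πℤ` is continuous. [bookkeeping] -/
theorem continuous_circleNorm : Continuous fun θ : ℝ => ‖((θ : ℝ) : AddCircle (2 * π))‖ := by
  fun_prop

/-! ## §2 ★★ Trigonometric smoothing of a Lipschitz link on `[0, d]` [folklore] -/

/-- ★★ **TRIGONOMETRIC SMOOTHING OF A LIPSCHITZ LINK ON `[0, d]`.**  Let `d > 0`, `K ≥ 0`, `h : ℝ → ℝ` with `|h(s) − h(s′)| ≤ K|s − s′|` on `[0, d]`,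
and `L ≥ 1`.  Then there are `α, β, ω : ℕ × ℕ → ℝ` (`0 ≤ ω_p`, `ω_p ≤ Lπ∕d` on `range L × range L`, `Σ_p(|α_p| + |β_p|) ≤ 2LKd`) and functions
`g, g₁ : ℝ → ℝ` with `g(s) = h(0) + Σ_p(α_p cos(ω_ps) + β_p sin(ω_ps))`, `g₁(s) = Σ_p ω_p(β_p cos(ω_ps) − α_p sin(ω_ps))`,
`|g(u) − g(a) − g₁(a)(u − a)| ≤ (KπL∕d)(u − a)²` and `|g₁(a)| ≤ K` for all reals, and `|h(s) − g(s)| ≤ Kd·(1∕π + 1 + log L)∕L` for `s ∈ [0, d]`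
(`g(s) = h(0) + G(πs∕d)`, `G` = module 150b's Fejér–Steklov smoothing, with `δ = 1∕L`, of `f(θ) = h((d∕π)‖θ‖_{ℝ∕2πℤ}) − h(0)`).
READING: module 151's input with `B₂ = KπL∕d`, `B₁ = K`, `W = 2LKd`, `Ω = Lπ∕d` — every constant priced by `K`; the smoothing error
`≍ Kd·log L∕L` is the Fejér kernel's (a Jackson kernel would give `Kd∕L`). [folklore] -/
theorem exists_trigLink_near_lipschitzLink {d : ℝ} (hd : 0 < d) {h : ℝ → ℝ} {K : ℝ} (hK0 : 0 ≤ K)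
    (hK : ∀ s s', s ∈ Set.Icc (0 : ℝ) d → s' ∈ Set.Icc (0 : ℝ) d → |h s - h s'| ≤ K * |s - s'|) {L : ℕ} (hL : 1 ≤ L) :
    ∃ (α β ω : ℕ × ℕ → ℝ) (g g₁ : ℝ → ℝ), (∀ p, 0 ≤ ω p) ∧ (∀ p ∈ range L ×ˢ range L, ω p ≤ L * π / d) ∧
      (∑ p ∈ range L ×ˢ range L, (|α p| + |β p|) ≤ 2 * L * (K * d)) ∧
      (∀ s, g s = h 0 + ∑ p ∈ range L ×ˢ range L, (α p * Real.cos (ω p * s) + β p * Real.sin (ω p * s))) ∧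
      (∀ s, g₁ s = ∑ p ∈ range L ×ˢ range L, ω p * (β p * Real.cos (ω p * s) - α p * Real.sin (ω p * s))) ∧
      (∀ u a, |g u - g a - g₁ a * (u - a)| ≤ K * π * L / d * (u - a) ^ 2) ∧ (∀ a, |g₁ a| ≤ K) ∧
      ∀ s ∈ Set.Icc (0 : ℝ) d, |h s - g s| ≤ K * d * (1 / π + 1 + Real.log L) / L := by
  have hπ := Real.pi_pos
  have hLr : (0 : ℝ) < L := by exact_mod_cast hL
  set P : Finset (ℕ × ℕ) := range L ×ˢ range L with hP
  -- the transported function on the circle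
  set nrm : ℝ → ℝ := fun θ => ‖((θ : ℝ) : AddCircle (2 * π))‖ with hnrm
  set f : ℝ → ℝ := fun θ => h (d / π * nrm θ) - h 0 with hf
  have harg : ∀ θ, d / π * nrm θ ∈ Set.Icc (0 : ℝ) d := by
    intro θ
    obtain ⟨h0, h1⟩ := circleNorm_mem_Icc θ
    refine ⟨by positivity, ?_⟩
    calc d / π * nrm θ ≤ d / π * π := mul_le_mul_of_nonneg_left h1 (by positivity)
      _ = d := by field_simp
  have h0mem : (0 : ℝ) ∈ Set.Icc (0 : ℝ) d := ⟨le_rfl, hd.le⟩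
  have hfLip : ∀ a b, |f a - f b| ≤ K * d / π * |a - b| := by
    intro a b
    rw [hf]
    show |h (d / π * nrm a) - h 0 - (h (d / π * nrm b) - h 0)| ≤ K * d / π * |a - b|
    rw [show h (d / π * nrm a) - h 0 - (h (d / π * nrm b) - h 0) = h (d / π * nrm a) - h (d / π * nrm b) by ring]
    calc |h (d / π * nrm a) - h (d / π * nrm b)| ≤ K * |d / π * nrm a - d / π * nrm b| := hK _ _ (harg a) (harg b)
      _ = K * d / π * |nrm a - nrm b| := by
          rw [← mul_sub, abs_mul, abs_of_pos (by positivity : (0 : ℝ) < d / π)]; ring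
      _ ≤ K * d / π * |a - b| := mul_le_mul_of_nonneg_left (abs_circleNorm_sub_le a b) (by positivity)
  have hfM : ∀ θ, |f θ| ≤ K * d := by
    intro θ
    rw [hf]
    show |h (d / π * nrm θ) - h 0| ≤ K * d
    calc |h (d / π * nrm θ) - h 0| ≤ K * |d / π * nrm θ - 0| := hK _ _ (harg θ) h0mem
      _ ≤ K * d := by
          refine mul_le_mul_of_nonneg_left ?_ hK0
          rw [sub_zero, abs_of_nonneg (harg θ).1]; exact (harg θ).2
  have hfper : Function.Periodic f (2 * π) := by
    intro θ
    rw [hf]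
    show h (d / π * nrm (θ + 2 * π)) - h 0 = h (d / π * nrm θ) - h 0
    rw [hnrm]
    show h (d / π * ‖((θ + 2 * π : ℝ) : AddCircle (2 * π))‖) - h 0 = h (d / π * ‖((θ : ℝ) : AddCircle (2 * π))‖) - h 0
    rw [circleNorm_add_two_pi]
  have hfc : Continuous f := by
    have hLipOn : LipschitzOnWith (Real.toNNReal K) h (Set.Icc (0 : ℝ) d) := by
      refine LipschitzOnWith.of_dist_le_mul fun x hx y hy => ?_
      rw [Real.dist_eq, Real.dist_eq, Real.coe_toNNReal _ hK0]
      exact hK x y hx hy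
    have hcont : Continuous fun θ => h (d / π * nrm θ) :=
      hLipOn.continuousOn.comp_continuous (continuous_const.mul continuous_circleNorm) harg
    rw [hf]; exact hcont.sub continuous_const
  -- the Fejér–Steklov smoothing on the circle, `δ = 1/L`
  have hδ : (0 : ℝ) < 1 / L := by positivity
  obtain ⟨α, β, ω, hω0, hωL, hmass, hC11, hB1, herr⟩ :=
    exists_trigLink_near_periodicLipschitz hfc hfper hfLip hfM hL hδ
  -- rescale `θ = πs/d`
  refine ⟨α, β, fun p => ω p * (π / d),
    fun s => h 0 + ∑ p ∈ P, (α p * Real.cos (ω p * (π / d) * s) + β p * Real.sin (ω p * (π / d) * s)),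
    fun s => ∑ p ∈ P, ω p * (π / d) * (β p * Real.cos (ω p * (π / d) * s) - α p * Real.sin (ω p * (π / d) * s)),
    fun p => mul_nonneg (hω0 p) (by positivity), ?_, hmass, fun s => rfl, fun s => rfl, ?_, ?_, ?_⟩
  · -- frequencies
    intro p hp
    calc ω p * (π / d) ≤ L * (π / d) := mul_le_mul_of_nonneg_right (hωL p hp) (by positivity)
      _ = L * π / d := by ring
  · -- `C^{1,1}` by rescaling
    intro u a
    beta_reduce
    have key := hC11 (π * u / d) (π * a / d)
    have e1 : ∀ s, (∑ p ∈ P, (α p * Real.cos (ω p * (π / d) * s) + β p * Real.sin (ω p * (π / d) * s))) =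
        ∑ p ∈ P, (α p * Real.cos (ω p * (π * s / d)) + β p * Real.sin (ω p * (π * s / d))) := by
      intro s; refine Finset.sum_congr rfl fun p _ => ?_; ring_nf
    have e2 : (∑ p ∈ P, ω p * (π / d) * (β p * Real.cos (ω p * (π / d) * a) - α p * Real.sin (ω p * (π / d) * a))) * (u - a) =
        (∑ p ∈ P, ω p * (β p * Real.cos (ω p * (π * a / d)) - α p * Real.sin (ω p * (π * a / d)))) * (π * u / d - π * a / d) := by
      rw [Finset.sum_mul, Finset.sum_mul]
      refine Finset.sum_congr rfl fun p _ => ?_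
      have ec : Real.cos (ω p * (π / d) * a) = Real.cos (ω p * (π * a / d)) := by ring_nf
      have es : Real.sin (ω p * (π / d) * a) = Real.sin (ω p * (π * a / d)) := by ring_nf
      rw [ec, es]
      field_simp
    have e3 : h 0 + (∑ p ∈ P, (α p * Real.cos (ω p * (π / d) * u) + β p * Real.sin (ω p * (π / d) * u))) -
        (h 0 + ∑ p ∈ P, (α p * Real.cos (ω p * (π / d) * a) + β p * Real.sin (ω p * (π / d) * a))) -
        (∑ p ∈ P, ω p * (π / d) * (β p * Real.cos (ω p * (π / d) * a) - α p * Real.sin (ω p * (π / d) * a))) * (u - a) =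
        (∑ p ∈ P, (α p * Real.cos (ω p * (π * u / d)) + β p * Real.sin (ω p * (π * u / d)))) -
        (∑ p ∈ P, (α p * Real.cos (ω p * (π * a / d)) + β p * Real.sin (ω p * (π * a / d)))) -
        (∑ p ∈ P, ω p * (β p * Real.cos (ω p * (π * a / d)) - α p * Real.sin (ω p * (π * a / d)))) * (π * u / d - π * a / d) := by
      rw [e1 u, e1 a, e2]; ring
    rw [e3]
    refine key.trans (le_of_eq ?_)
    rw [show π * u / d - π * a / d = (π / d) * (u - a) by ring, mul_pow]
    field_simp
  · -- `|g₁| ≤ K`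
    intro a
    beta_reduce
    have key := hB1 (π * a / d)
    have e : (∑ p ∈ P, ω p * (π / d) * (β p * Real.cos (ω p * (π / d) * a) - α p * Real.sin (ω p * (π / d) * a))) =
        (π / d) * ∑ p ∈ P, ω p * (β p * Real.cos (ω p * (π * a / d)) - α p * Real.sin (ω p * (π * a / d))) := by
      rw [Finset.mul_sum]
      refine Finset.sum_congr rfl fun p _ => ?_; ring_nf
    rw [e, abs_mul, abs_of_pos (by positivity : (0 : ℝ) < π / d)]
    calc π / d * |∑ p ∈ P, ω p * (β p * Real.cos (ω p * (π * a / d)) - α p * Real.sin (ω p * (π * a / d)))|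
        ≤ π / d * (K * d / π) := mul_le_mul_of_nonneg_left key (by positivity)
      _ = K := by field_simp
  · -- the error on `[0, d]`
    intro s hs
    beta_reduce
    have hθ0 : 0 ≤ π * s / d := by have := hs.1; positivity
    have hθπ : π * s / d ≤ π := by
      rw [div_le_iff₀ hd]; nlinarith [hs.2, hπ]
    have hfs : f (π * s / d) = h s - h 0 := by
      rw [hf, hnrm]
      show h (d / π * ‖((π * s / d : ℝ) : AddCircle (2 * π))‖) - h 0 = h s - h 0
      rw [circleNorm_of_mem_Icc hθ0 hθπ]
      congr 2
      field_simp
    have key := herr (π * s / d)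
    rw [hfs] at key
    have e1 : (∑ p ∈ P, (α p * Real.cos (ω p * (π / d) * s) + β p * Real.sin (ω p * (π / d) * s))) =
        ∑ p ∈ P, (α p * Real.cos (ω p * (π * s / d)) + β p * Real.sin (ω p * (π * s / d))) := by
      refine Finset.sum_congr rfl fun p _ => ?_; ring_nf
    rw [show h s - (h 0 + ∑ p ∈ P, (α p * Real.cos (ω p * (π / d) * s) + β p * Real.sin (ω p * (π / d) * s))) =
      -((∑ p ∈ P, (α p * Real.cos (ω p * (π * s / d)) + β p * Real.sin (ω p * (π * s / d)))) - (h s - h 0)) by rw [e1]; ring,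
      abs_neg]
    refine key.trans (le_of_eq ?_)
    field_simp
    ring

end Summit.QuantumFields.YangMills.Theorems.BalabanUVNodesN19LipschitzLinkTrigSmoothing

end
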